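import Summits.FinalStateConjecture.FinalStateConjecture.Theorems.EIHFluxBalanceInertialRecessionRechartAssembly
import Summits.FinalStateConjecture.FinalStateConjecture.Theorems.EIHFluxBalanceInertialRecessionRechartKinematics
import Summits.FinalStateConjecture.FinalStateConjecture.Theorems.EIHFluxBalanceInertialRecessionRechartOfut
import Summits.FinalStateConjecture.FinalStateConjecture.Theorems.EIHFluxBalanceInertialRecessionNoHoles
import Mathlib
import HarnessLib
import Summits.FinalStateConjecture.Statement
import Literature.Geometry.Lorentzian.LandauLifshitzPseudotensor

/-!
# Route EIHFluxBalance — `InertialRecession`: the `a = 0` RE-CHARTING THEOREM, conditional on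
# explicit causal clauses (orthochronous frames, future-oriented lab chart, near-horizon loitering)
# and on velocity convergence

Helper file for the crux `stmt-FinalStateConjecture-10166`
(`Summit.FinalStateConjecture.FinalStateConjecture.Theses.EIHFluxBalance.InertialRecession`),
stub `stub_rechart` (the transfer P2 of line `sublinear-is-free-clean-window-charges`).

`inertialRecession_spinZero_of_causal`: the crux antecedent VERBATIM, with all spins `aᵢ = 0`,
third-order slaving (the line's `Slaved³` clause, verbatim), VELOCITY CONVERGENCE `ξ̇ᵢ → Vᵢ`,
Cesàro velocities (verbatim; implied by the former, kept for the interface), and three causal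
clauses on the lab chart — (O) the painted frames are orthochronous, (Ofut) the lab chart is
future-oriented on the late guaranteed region (`Φ_* w` future-directed for `Φ^*g`-timelike `w` with
`w⁰ > 0`), (Hov) near-horizon loitering for every hole (path form) — imply the crux CONCLUSION:
a `C²` `FinalStateDecomposition` with sub-extremal holes, `O′ = exteriorOf d.charted`,
`HasExhaustiveCharts`. `N = 0` is the landed `inertialRecession_noHoles`; for `N ≥ 1` the
kinematic glue (`…RechartKinematics`) feeds `exists_finalStateDecomposition_spinZero_of_packages`
(`…RechartAssembly`). Compared with the registered `stub_rechart` the extra hypotheses are exactly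
(aᵢ = 0), (Vel), (O), (Ofut), (Hov); lab-time causality is not used. Why the extras: (Hov) —
exhaustion toward LAB slabs supplies causal curves with uncontrolled paths, and in the `ε`-layer
above a painted horizon no explicit curve is certifiable, while escaping curves meet the tilted
slab `{t*ᵢ = τ₁}` at radius `≫ Rᵢ(τ₁)`; (Vel) — Cesàro + slaving admit sparse ever wider velocity
bumps. `inertialRecession_spinZero_of_labTimeCausality`: the same with (Ofut) replaced by the
registered EVENTUAL LAB-TIME CAUSALITY hypothesis of `stub_rechart` (which implies it,
`…RechartOfut`). [folklore]
-/

noncomputable section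

set_option linter.dupNamespace false

open scoped Topology ContDiff InnerProductSpace Manifold ENNReal BigOperators
open Filter Set Metric Topology Function TopologicalSpace Literature.Geometry.Lorentzian

namespace Summit.FinalStateConjecture.FinalStateConjecture.Theorems

/-! ### Velocity convergence implies Cesàro convergence -/

/-- If `ξ` is differentiable with `ξ̇ → V` then `t⁻¹ξ(t) → V`. [folklore] -/
theorem tendsto_inv_smul_of_tendsto_deriv {ξ : ℝ → E3} (hξ : Differentiable ℝ ξ) {V : E3}
    (h : Tendsto (deriv ξ) atTop (𝓝 V)) : Tendsto (fun t : ℝ ↦ t⁻¹ • ξ t) atTop (𝓝 V) := by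
  set g : ℝ → E3 := fun t ↦ ξ t - t • V with hg
  have hgd : ∀ t, HasDerivAt g (deriv ξ t - V) t := fun t ↦
    (hξ t).hasDerivAt.sub ((hasDerivAt_id t).smul_const V |>.congr_deriv (by simp))
  have hg' : Tendsto (fun t ↦ deriv ξ t - V) atTop (𝓝 0) := by
    simpa using h.sub_const V
  rw [Metric.tendsto_atTop]
  intro ε hε
  have hε2 : 0 < ε / 2 := by positivity
  obtain ⟨T₁, hT₁⟩ := (Metric.tendsto_atTop.mp hg') (ε / 2) hε2
  set T : ℝ := max T₁ 1 with hT
  have hT1 : 1 ≤ T := le_max_right _ _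
  -- mean value bound on `[T, t]`
  have hmv : ∀ t, T ≤ t → ‖g t - g T‖ ≤ ε / 2 * (t - T) := by
    intro t ht
    have hb : ∀ s ∈ Icc T t, ‖deriv ξ s - V‖ ≤ ε / 2 := fun s hs ↦ by
      have := hT₁ s ((le_max_left _ _).trans hs.1)
      rw [dist_zero_right] at this
      exact this.le
    have h := Convex.norm_image_sub_le_of_norm_hasDerivWithin_le (f := g)
      (f' := fun s ↦ deriv ξ s - V) (s := Icc T t) (fun s _ ↦ (hgd s).hasDerivWithinAt) hb
      (convex_Icc T t) (left_mem_Icc.mpr ht) (right_mem_Icc.mpr ht)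
    rwa [Real.norm_eq_abs, abs_of_nonneg (sub_nonneg.mpr ht)] at h
  set T₂ : ℝ := max T (2 * ‖g T‖ / ε + 1) with hT₂
  refine ⟨T₂, fun t ht ↦ ?_⟩
  have htT : T ≤ t := (le_max_left _ _).trans ht
  have ht0 : 0 < t := by linarith
  have hgt : ‖g t‖ ≤ ‖g T‖ + ε / 2 * (t - T) := by
    have := hmv t htT
    linarith [norm_le_norm_add_norm_sub' (g t) (g T), norm_sub_rev (g t) (g T)]
  have hkey : t⁻¹ • ξ t - V = t⁻¹ • g t := by
    rw [hg]; simp only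
    rw [smul_sub, smul_smul, inv_mul_cancel₀ ht0.ne', one_smul]
  rw [dist_eq_norm, hkey, norm_smul, Real.norm_eq_abs, abs_of_pos (inv_pos.mpr ht0)]
  rw [inv_mul_lt_iff₀ ht0]
  have h1 : 2 * ‖g T‖ / ε + 1 ≤ t := (le_max_right _ _).trans ht
  have h2 : 2 * ‖g T‖ < ε * t := by
    rw [div_add_one (ne_of_gt hε), div_le_iff₀ hε] at h1
    nlinarith [norm_nonneg (g T)]
  nlinarith [norm_nonneg (g T)]

/-- Registered one-line form (stub `cesaro_of_tendsto_deriv_rechart` of the crux item) of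
`tendsto_inv_smul_of_tendsto_deriv`. [folklore] -/
theorem cesaro_of_tendsto_deriv_rechart : open Filter Topology Literature.Geometry.Lorentzian in ∀ {ξ : ℝ → E3}, Differentiable ℝ ξ → ∀ {V : E3}, Tendsto (deriv ξ) atTop (𝓝 V) → Tendsto (fun t : ℝ ↦ t⁻¹ • ξ t) atTop (𝓝 V) :=
  fun hξ _ h ↦ tendsto_inv_smul_of_tendsto_deriv hξ h

/-! ### The conditional re-charting theorem -/

-- long statement and long bookkeeping proof
set_option maxHeartbeats 1600000 in
/-- **`InertialRecession`, re-charting for Schwarzschild holes, conditional.** See the module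
docstring. -/
theorem inertialRecession_spinZero_of_causal : ∀ (X : Type) [TopologicalSpace X] [ChartedSpace E3 X] [IsManifold (𝓡 3) ((⊤ : ℕ∞) : WithTop ℕ∞) X] [T2Space X] [SecondCountableTopology X] [ConnectedSpace X], ∀ D ∈ admissibleVacuumData X, ∀ 𝒟 : VacuumCauchyDevelopment D, 𝒟.IsMaximal → ∀ (N : ℕ) (M a rin : Fin N → ℝ) (Λ : Fin N → ℝ → lorentzGroup) (ξ : Fin N → ℝ → E3) (γ κ τ₀ : ℝ) (U : Opens E4) (Φ : U → 𝒟.carrier) (O : Set 𝒟.carrier), ((∀ i, Kerr.IsSubextremal (M i) (a i) ∧ Kerr.rMinus (M i) (a i) < rin i ∧ rin i < Kerr.rPlus (M i) (a i)) ∧ (∀ i t, |((Λ i t : E4 ≃L[ℝ] E4) (E4.basisVector 0)) 0| ≤ γ) ∧ (∀ i, ContDiff ℝ ((⊤ : ℕ∞) : WithTop ℕ∞) (ξ i) ∧ ContDiff ℝ ((⊤ : ℕ∞) : WithTop ℕ∞) (fun t ↦ ((Λ i t : E4 ≃L[ℝ] E4) : E4 →L[ℝ] E4))) ∧ (∀ i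 j, i ≠ j → Tendsto (fun t ↦ ‖ξ i t - ξ j t‖) atTop atTop) ∧ (0 < κ ∧ κ < 1 ∧ ∀ i, ∀ᶠ t in atTop, ‖ξ i t‖ ≤ κ ^ 2 * t) ∧ ({x : E4 | τ₀ < x 0 ∧ ∀ i, rin i < Kerr.radius (a i) (poincareInv (Λ i (x 0)) (E4.ofTimeSpace (x 0) (ξ i (x 0))) x)} ⊆ (U : Set E4)) ∧ let B : ModelBackground := ⟨U, fun x ↦ Minkowski.bilin + ∑ i, (boostedKerrBilin (Λ i (x 0)) (E4.ofTimeSpace (x 0) (ξ i (x 0))) (M i) (a i) x - Minkowski.bilin), fun x ↦ x 0, E4.spatialNorm⟩; ContMDiff 𝓘(ℝ, E4) (𝓡 4) ((⊤ : ℕ∞) : WithTop ℕ∞) Φ ∧ Topology.IsOpenEmbedding ((B.lateRegion τ₀).restrict Φ) ∧ Φ '' {x : U | τ₀ < x.1 0 ∧ ∀ i, Kerr.rPlus (M i) (a i) < Kerr.radius (a i) (poincareInv (Λ i (x.1 0)) (E4.ofTimeSpace (x.1 0) (ξ i (x.1 0))) x.1)} ⊆ O ∧ Tendsto (fun t ↦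 𝒟.toSpacetime.deviationCk B Φ 3 t) atTop (𝓝 0) ∧ Tendsto (fun t : ℝ ↦ ⨆ x ∈ {x : U | x.1 0 = t ∧ E4.spatialNorm x.1 ≤ κ * t}, ⨆ (m : ℕ) (_ : m ≤ 3), ENNReal.ofReal (1 + √(√((⨅ i, ‖E4.spatial x.1 - ξ i t‖) ^ 7))) * ‖iteratedFDeriv ℝ m (𝒟.toSpacetime.deviationExtend B Φ) x.1‖ₑ) atTop (𝓝 0) ∧ O = Summit.FinalStateConjecture.exteriorOf 𝒟.toCauchyDevelopment (Φ '' {x : U | τ₀ < x.1 0 ∧ ∀ i, Kerr.rPlus (M i) (a i) < Kerr.radius (a i) (poincareInv (Λ i (x.1 0)) (E4.ofTimeSpace (x.1 0) (ξ i (x.1 0))) x.1)}) ∧ ∀ t₁ : ℝ, τ₀ < t₁ → O \ Φ '' {x : U | t₁ < x.1 0 ∧ ∀ i, Kerr.rPlus (M i) (a i) < Kerr.radius (a i) (poincareInv (Λ i (x.1 0)) (E4.ofTimeSpace (x.1 0) (ξ i (x.1 0))) x.1)} ⊆ 𝒟.metric.causalPast 𝒟.timeOrientation (Φ '' {x : U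 | x.1 0 = t₁ ∧ ∀ i, Kerr.rPlus (M i) (a i) < Kerr.radius (a i) (poincareInv (Λ i (x.1 0)) (E4.ofTimeSpace (x.1 0) (ξ i (x.1 0))) x.1)})) →
    (∀ i : Fin N, a i = 0) →
    (∀ i : Fin N, (∀ m : ℕ, 1 ≤ m → m ≤ 3 → Tendsto (fun t ↦ iteratedDeriv m (fun s ↦ (((Λ i s : lorentzGroup) : E4 ≃L[ℝ] E4) (E4.basisVector 0))) t) atTop (𝓝 0)) ∧ (∀ m : ℕ, m ≤ 2 → Tendsto (fun t ↦ iteratedDeriv m (fun s ↦ deriv (ξ i) s - (((((Λ i s : lorentzGroup) : E4 ≃L[ℝ] E4) (E4.basisVector 0)) 0)⁻¹ • E4.spatial (((Λ i s : lorentzGroup) : E4 ≃L[ℝ] E4) (E4.basisVector 0)))) t) atTop (𝓝 0)) ∧ (a i ≠ 0 → ∀ m : ℕ, 1 ≤ m → m ≤ 3 → Tendsto (fun t ↦ iteratedDeriv m (fun s ↦ (((Λ i s : lorentzGroup) : E4 ≃L[ℝ] E4) (E4.basisVector 3))) t) atTop (𝓝 0))) →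
    (∀ i : Fin N, ∃ V : E3, Tendsto (deriv (ξ i)) atTop (𝓝 V)) →
    (∀ i : Fin N, ∃ V : E3, Tendsto (fun t : ℝ ↦ t⁻¹ • ξ i t) atTop (𝓝 V)) →
    (∀ (i : Fin N) (t : ℝ), 0 < (((Λ i t : lorentzGroup) : E4 ≃L[ℝ] E4) (E4.basisVector 0)) 0) →
    (∃ TO : ℝ, ∀ x : U, TO < x.1 0 → (∀ j, rin j < Kerr.radius (a j) (poincareInv (Λ j (x.1 0)) (E4.ofTimeSpace (x.1 0) (ξ j (x.1 0))) x.1)) → ∀ w : E4, 0 < w 0 → 𝒟.metric.val (Φ x) (mfderiv 𝓘(ℝ, E4) (𝓡 4) Φ x w) (mfderiv 𝓘(ℝ, E4) (𝓡 4) Φ x w) < 0 → 𝒟.timeOrientation.IsFutureDirected (mfderiv 𝓘(ℝ, E4) (𝓡 4) Φ x w)) →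
    (∀ i : Fin N, ∃ δ K TH : ℝ, 0 < δ ∧ Kerr.rPlus (M i) (a i) + δ < K ∧ ∀ x : U, TH < x.1 0 → (∀ j, Kerr.rPlus (M j) (a j) < Kerr.radius (a j) (poincareInv (Λ j (x.1 0)) (E4.ofTimeSpace (x.1 0) (ξ j (x.1 0))) x.1)) → Kerr.radius (a i) (poincareInv (Λ i (x.1 0)) (E4.ofTimeSpace (x.1 0) (ξ i (x.1 0))) x.1) < Kerr.rPlus (M i) (a i) + δ → ∀ s : ℝ, 0 < s → ∃ (γc : ℝ → 𝒟.carrier) (b : ℝ), 0 < b ∧ 𝒟.metric.IsFutureCausalCurveOn 𝒟.timeOrientation γc (Set.Icc 0 b) ∧ γc 0 = Φ x ∧ γc b ∈ Φ '' {z : U | z.1 0 = x.1 0 + s ∧ Kerr.rPlus (M i) (a i) < Kerr.radius (a i) (poincareInv (Λ i (z.1 0)) (E4.ofTimeSpace (z.1 0) (ξ i (z.1 0))) z.1) ∧ Kerr.radius (a i) (poincareInv (Λ i (z.1 0)) (E4.ofTimeSpace (z.1 0) (ξ i (z.1 0))) z.1) < K} ∧ ∀ σ ∈ Set.Icc 0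 b, γc σ ∈ Φ '' {z : U | x.1 0 ≤ z.1 0 ∧ Kerr.rPlus (M i) (a i) < Kerr.radius (a i) (poincareInv (Λ i (z.1 0)) (E4.ofTimeSpace (z.1 0) (ξ i (z.1 0))) z.1) ∧ Kerr.radius (a i) (poincareInv (Λ i (z.1 0)) (E4.ofTimeSpace (z.1 0) (ξ i (z.1 0))) z.1) < K}) →
    ∃ (O : Set 𝒟.carrier) (d : FinalStateDecomposition 𝒟.toSpacetime O 2), (∀ i, Kerr.IsSubextremal (d.mass i) (d.spin i)) ∧ O = Summit.FinalStateConjecture.exteriorOf 𝒟.toCauchyDevelopment d.charted ∧ Summit.FinalStateConjecture.HasExhaustiveCharts d := by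
  intro X _ _ _ _ _ _ D hD 𝒟 h𝒟 N M a rin Λ ξ γ κ τ₀ U Φ O hL ha hS hVel _ hOrth hOfut hHov
  rcases Nat.eq_zero_or_pos N with hN0 | hN
  · subst hN0
    exact inertialRecession_noHoles X D 𝒟 ⟨M, a, rin, Λ, ξ, γ, κ, τ₀, U, Φ, O, hL⟩
  have ha' : a = fun _ ↦ 0 := funext ha
  subst ha'
  obtain ⟨hsub, hγb, hsm, hsep, -, hU, hB⟩ := hL
  obtain ⟨hΦ, hemb, himO, hdev, -, hO, hexh⟩ := hB
  obtain ⟨TO, hOfut⟩ := hOfut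
  beta_reduce at hsub hU hemb himO hdev hO hexh hOfut hHov
  -- ### kinematics
  have hu0 : ∀ i t, 0 < (((Λ i t : lorentzGroup) : E4 ≃L[ℝ] E4) (E4.basisVector 0)) 0 := hOrth
  have hu1 : ∀ i t, 1 ≤ (((Λ i t : lorentzGroup) : E4 ≃L[ℝ] E4) (E4.basisVector 0)) 0 := fun i t ↦ by
    have := one_le_abs_lorentz_apply_zero (Λ i t)
    rwa [abs_of_pos (hu0 i t)] at this
  have huγ : ∀ i t, (((Λ i t : lorentzGroup) : E4 ≃L[ℝ] E4) (E4.basisVector 0)) 0 ≤ γ := fun i t ↦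
    (le_abs_self _).trans (hγb i t)
  have hγ1 : 1 ≤ γ := (hu1 ⟨0, hN⟩ 0).trans (huγ ⟨0, hN⟩ 0)
  obtain ⟨v, hv⟩ : ∃ v : Fin N → ℝ → E3, v = fun i t ↦
      ((((Λ i t : lorentzGroup) : E4 ≃L[ℝ] E4) (E4.basisVector 0)) 0)⁻¹ •
        E4.spatial (((Λ i t : lorentzGroup) : E4 ≃L[ℝ] E4) (E4.basisVector 0)) := ⟨_, rfl⟩
  have hS1 : ∀ i, ∀ m : ℕ, 1 ≤ m → m ≤ 3 → Tendsto (fun t ↦ iteratedDeriv m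
      (fun s ↦ ((Λ i s : lorentzGroup) : E4 ≃L[ℝ] E4) (E4.basisVector 0)) t) atTop (𝓝 0) :=
    fun i ↦ (hS i).1
  have hS2 : ∀ i, ∀ m : ℕ, m ≤ 2 → Tendsto (fun t ↦ iteratedDeriv m (fun s ↦ deriv (ξ i) s - v i s) t)
      atTop (𝓝 0) := by
    subst hv; exact fun i ↦ (hS i).2.1
  clear hS
  set κ₀ : ℝ := Real.sqrt (1 - (γ ^ 2)⁻¹) with hκ₀
  have hvs : ∀ i t, ‖v i t‖ ≤ κ₀ := fun i t ↦ by
    rw [hv]; exact (norm_labVelocity_le_sqrt (Λ i t) (hu0 i t) (huγ i t)).1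
  have hκ₀1 : κ₀ < 1 := (norm_labVelocity_le_sqrt (Λ ⟨0, hN⟩ 0) (hu0 _ 0) (huγ _ 0)).2
  have hvΛ : ∀ i t, E4.spatial (((Λ i t : lorentzGroup) : E4 ≃L[ℝ] E4) (E4.basisVector 0)) =
      ((((Λ i t : lorentzGroup) : E4 ≃L[ℝ] E4) (E4.basisVector 0)) 0) • v i t := fun i t ↦ by
    rw [hv]; exact spatial_eq_smul_labVelocity (hu0 i t).ne'
  have hucd : ∀ i, ContDiff ℝ ∞ fun t ↦ ((Λ i t : lorentzGroup) : E4 ≃L[ℝ] E4) (E4.basisVector 0) :=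
    fun i ↦ (hsm i).2.clm_apply contDiff_const
  have hvcd : ∀ i, ContDiff ℝ ∞ (v i) := fun i ↦ by
    rw [hv]; exact contDiff_labVelocity (hucd i) fun s ↦ (hu0 i s).ne'
  have hξcd : ∀ i, ContDiff ℝ ∞ (ξ i) := fun i ↦ (hsm i).1
  -- size of the 4-velocity: `‖u‖² = 2(u⁰)² − 1 ≤ 2γ²`
  have huC : ∀ i t, ‖((Λ i t : lorentzGroup) : E4 ≃L[ℝ] E4) (E4.basisVector 0)‖ ≤ Real.sqrt (2 * γ ^ 2) := by
    intro i t
    refine Real.le_sqrt_of_sq_le ?_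
    have h1 := norm_sq_eq_sq_add_spatialNorm_sq (((Λ i t : lorentzGroup) : E4 ≃L[ℝ] E4) (E4.basisVector 0))
    have h2 := lorentz_apply_zero_sq (Λ i t)
    have h3 := huγ i t
    have h4 := hu1 i t
    nlinarith
  -- rates of the lab velocity and of the centre
  have hv0 : ∀ i l, 1 ≤ l → l ≤ 3 → Tendsto (fun t ↦ iteratedDeriv l (v i) t) atTop (𝓝 0) := fun i ↦ by
    rw [hv]
    exact tendsto_iteratedDeriv_labVelocity ((hucd i).of_le (WithTop.coe_le_coe.mpr le_top : ((3 : ℕ∞) : ℕ∞ω) ≤ ((⊤ : ℕ∞) : ℕ∞ω))) (hu1 i)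
      (huC i) (hS1 i)
  have hξ0 : ∀ i l, 2 ≤ l → l ≤ 3 → Tendsto (fun t ↦ iteratedDeriv l (ξ i) t) atTop (𝓝 0) := fun i ↦
    tendsto_iteratedDeriv_centre (hξcd i) (hvcd i) (hS2 i) fun l hl1 hl2 ↦ hv0 i l hl1 (hl2.trans (by norm_num))
  -- velocity limits
  choose V hξV using hVel
  have hmis : ∀ i, Tendsto (fun t ↦ deriv (ξ i) t - v i t) atTop (𝓝 0) := fun i ↦ by
    simpa using hS2 i 0 (Nat.zero_le 2)
  have hvV : ∀ i, Tendsto (v i) atTop (𝓝 (V i)) := fun i ↦ by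
    have h := (hξV i).sub (hmis i)
    rw [sub_zero] at h
    exact h.congr fun t ↦ by simp
  have hV1 : ∀ i, ‖V i‖ < 1 := fun i ↦
    (le_of_tendsto' (hvV i).norm fun t ↦ hvs i t).trans_lt hκ₀1
  have hces : ∀ i, Tendsto (fun t : ℝ ↦ t⁻¹ • ξ i t) atTop (𝓝 (V i)) := fun i ↦
    tendsto_inv_smul_of_tendsto_deriv ((hξcd i).differentiable (by simp)) (hξV i)
  -- eventual bounds on two derivatives
  have hbd : ∀ i, ∀ᶠ t in atTop, (∀ l, 1 ≤ l → l ≤ 2 → ‖iteratedDeriv l (v i) t‖ ≤ ‖(0 : E3)‖ + 1 + ‖V i‖) ∧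
      ∀ l, 1 ≤ l → l ≤ 2 → ‖iteratedDeriv l (ξ i) t‖ ≤ ‖(0 : E3)‖ + 1 + ‖V i‖ := by
    intro i
    have e1 := eventually_norm_le_of_tendsto (hv0 i 1 le_rfl (by norm_num))
    have e2 := eventually_norm_le_of_tendsto (hv0 i 2 (by norm_num) (by norm_num))
    have e3 := eventually_norm_le_of_tendsto (hξV i)
    have e4 := eventually_norm_le_of_tendsto (hξ0 i 2 le_rfl (by norm_num))
    filter_upwards [e1, e2, e3, e4] with t h1 h2 h3 h4
    refine ⟨fun l hl1 hl2 ↦ ?_, fun l hl1 hl2 ↦ ?_⟩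
    · interval_cases l
      · linarith [norm_nonneg (V i)]
      · linarith [norm_nonneg (V i)]
    · interval_cases l
      · rw [iteratedDeriv_one]; simp only [norm_zero]; linarith [h3]
      · linarith [norm_nonneg (V i)]
  obtain ⟨T₀, hT₀⟩ := eventually_atTop.1 (eventually_all.2 hbd)
  set Γ : ℝ := ‖(0 : E3)‖ + 1 + ∑ i, ‖V i‖ with hΓ
  have hΓi : ∀ i, ‖(0 : E3)‖ + 1 + ‖V i‖ ≤ Γ := fun i ↦ by
    have : ‖V i‖ ≤ ∑ i, ‖V i‖ :=
      Finset.single_le_sum (f := fun i ↦ ‖V i‖) (fun i _ ↦ norm_nonneg _) (Finset.mem_univ i)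
    rw [hΓ]; linarith
  have hvb : ∀ j t, T₀ ≤ t → ∀ l, 1 ≤ l → l ≤ 2 → ‖iteratedDeriv l (v j) t‖ ≤ Γ :=
    fun j t ht l hl1 hl2 ↦ ((hT₀ t ht j).1 l hl1 hl2).trans (hΓi j)
  have hξb : ∀ j t, T₀ ≤ t → ∀ l, 1 ≤ l → l ≤ 2 → ‖iteratedDeriv l (ξ j) t‖ ≤ Γ :=
    fun j t ht l hl1 hl2 ↦ ((hT₀ t ht j).2 l hl1 hl2).trans (hΓi j)
  -- `C²` lab deviation
  have hdev2 : Tendsto (fun t ↦ 𝒟.toSpacetime.deviationCk ⟨U, fun x ↦ Minkowski.bilin +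
      ∑ j, (boostedKerrBilin (Λ j (x 0)) (E4.ofTimeSpace (x 0) (ξ j (x 0))) (M j) 0 x -
        Minkowski.bilin), fun x ↦ x 0, E4.spatialNorm⟩ Φ 2 t) atTop (𝓝 0) :=
    tendsto_of_tendsto_of_tendsto_of_le_of_le tendsto_const_nhds hdev (fun _ ↦ zero_le)
      fun t ↦ 𝒟.toSpacetime.deviationCk_mono ⟨U, fun x ↦ Minkowski.bilin +
        ∑ j, (boostedKerrBilin (Λ j (x 0)) (E4.ofTimeSpace (x 0) (ξ j (x 0))) (M j) 0 x -
          Minkowski.bilin), fun x ↦ x 0, E4.spatialNorm⟩ Φ (by norm_num : 2 ≤ 3) t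
  -- ### the decomposition
  have hM : ∀ i, 0 < M i := fun i ↦ (abs_nonneg (0 : ℝ)).trans_lt (hsub i).1
  have hrin : ∀ j, rin j < Kerr.rPlus (M j) 0 := fun j ↦ (hsub j).2.2
  have hembΦ : IsOpenEmbedding (({x : U | τ₀ < x.1 0} : Set U).restrict Φ) := hemb
  exact exists_finalStateDecomposition_spinZero_of_packages 𝒟 ⟨0, hN⟩ M rin hM hrin Λ ξ v hu0 hvΛ U Φ
    hΦ hdev2 hκ₀1 hvs hvcd hξcd hvb hξb hsep V hV1 hvV hξV hξ0 hv0 hces hU hembΦ O hO himO hexh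
    hOfut hHov

/-- **The `a = 0` re-charting theorem, with EVENTUAL LAB-TIME CAUSALITY in place of the
future-orientation clause.** Same statement as `inertialRecession_spinZero_of_causal`, except that
hypothesis (Ofut) ("the lab chart is future-oriented on the late guaranteed region") is replaced by
the registered hypothesis of `stub_rechart`: eventual lab-time causality of the chart
(`Φ y ∈ J⁺(Φ x) ⇒ x⁰ ≤ y⁰` for late guaranteed `x, y`), verbatim. The late guaranteed region is
open (`isOpen_setOf_lt_radius_poincareInv`) and lab-time causality orients the chart there
(`isFutureDirected_mfderiv_of_labTimeCausality`). Remaining extra hypotheses w.r.t. `stub_rechart`: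
(aᵢ = 0), velocity convergence, orthochronous frames, near-horizon loitering. [folklore] -/
theorem inertialRecession_spinZero_of_labTimeCausality : ∀ (X : Type) [TopologicalSpace X] [ChartedSpace E3 X] [IsManifold (𝓡 3) ((⊤ : ℕ∞) : WithTop ℕ∞) X] [T2Space X] [SecondCountableTopology X] [ConnectedSpace X], ∀ D ∈ admissibleVacuumData X, ∀ 𝒟 : VacuumCauchyDevelopment D, 𝒟.IsMaximal → ∀ (N : ℕ) (M a rin : Fin N → ℝ) (Λ : Fin N → ℝ → lorentzGroup) (ξ : Fin N → ℝ → E3) (γ κ τ₀ : ℝ) (U : Opens E4) (Φ : U → 𝒟.carrier) (O : Set 𝒟.carrier), ((∀ i, Kerr.IsSubextremal (M i) (a i) ∧ Kerr.rMinus (M i) (a i) < rin i ∧ rin i < Kerr.rPlus (M i) (a i)) ∧ (∀ i t, |((Λ i t : E4 ≃L[ℝ] E4) (E4.basisVector 0)) 0| ≤ γ) ∧ (∀ i, ContDiff ℝ ((⊤ : ℕ∞) : WithTop ℕ∞) (ξ i) ∧ ContDiff ℝ ((⊤ : ℕ∞) : WithTop ℕ∞) (fun t ↦ ((Λ i t :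 E4 ≃L[ℝ] E4) : E4 →L[ℝ] E4))) ∧ (∀ i j, i ≠ j → Tendsto (fun t ↦ ‖ξ i t - ξ j t‖) atTop atTop) ∧ (0 < κ ∧ κ < 1 ∧ ∀ i, ∀ᶠ t in atTop, ‖ξ i t‖ ≤ κ ^ 2 * t) ∧ ({x : E4 | τ₀ < x 0 ∧ ∀ i, rin i < Kerr.radius (a i) (poincareInv (Λ i (x 0)) (E4.ofTimeSpace (x 0) (ξ i (x 0))) x)} ⊆ (U : Set E4)) ∧ let B : ModelBackground := ⟨U, fun x ↦ Minkowski.bilin + ∑ i, (boostedKerrBilin (Λ i (x 0)) (E4.ofTimeSpace (x 0) (ξ i (x 0))) (M i) (a i) x - Minkowski.bilin), fun x ↦ x 0, E4.spatialNorm⟩; ContMDiff 𝓘(ℝ, E4) (𝓡 4) ((⊤ : ℕ∞) : WithTop ℕ∞) Φ ∧ Topology.IsOpenEmbedding ((B.lateRegion τ₀).restrict Φ) ∧ Φ '' {x : U | τ₀ < x.1 0 ∧ ∀ i, Kerr.rPlus (M i) (a i) < Kerr.radius (a i) (poincareInv (Λ i (x.1 0)) (E4.ofTimeSpace (x.1 0)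 (ξ i (x.1 0))) x.1)} ⊆ O ∧ Tendsto (fun t ↦ 𝒟.toSpacetime.deviationCk B Φ 3 t) atTop (𝓝 0) ∧ Tendsto (fun t : ℝ ↦ ⨆ x ∈ {x : U | x.1 0 = t ∧ E4.spatialNorm x.1 ≤ κ * t}, ⨆ (m : ℕ) (_ : m ≤ 3), ENNReal.ofReal (1 + √(√((⨅ i, ‖E4.spatial x.1 - ξ i t‖) ^ 7))) * ‖iteratedFDeriv ℝ m (𝒟.toSpacetime.deviationExtend B Φ) x.1‖ₑ) atTop (𝓝 0) ∧ O = Summit.FinalStateConjecture.exteriorOf 𝒟.toCauchyDevelopment (Φ '' {x : U | τ₀ < x.1 0 ∧ ∀ i, Kerr.rPlus (M i) (a i) < Kerr.radius (a i) (poincareInv (Λ i (x.1 0)) (E4.ofTimeSpace (x.1 0) (ξ i (x.1 0))) x.1)}) ∧ ∀ t₁ : ℝ, τ₀ < t₁ → O \ Φ '' {x : U | t₁ < x.1 0 ∧ ∀ i, Kerr.rPlus (M i) (a i) < Kerr.radius (a i) (poincareInv (Λ i (x.1 0)) (E4.ofTimeSpace (x.1 0) (ξ i (x.1 0))) x.1)}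 ⊆ 𝒟.metric.causalPast 𝒟.timeOrientation (Φ '' {x : U | x.1 0 = t₁ ∧ ∀ i, Kerr.rPlus (M i) (a i) < Kerr.radius (a i) (poincareInv (Λ i (x.1 0)) (E4.ofTimeSpace (x.1 0) (ξ i (x.1 0))) x.1)})) →
    (∀ i : Fin N, a i = 0) →
    (∀ i : Fin N, (∀ m : ℕ, 1 ≤ m → m ≤ 3 → Tendsto (fun t ↦ iteratedDeriv m (fun s ↦ (((Λ i s : lorentzGroup) : E4 ≃L[ℝ] E4) (E4.basisVector 0))) t) atTop (𝓝 0)) ∧ (∀ m : ℕ, m ≤ 2 → Tendsto (fun t ↦ iteratedDeriv m (fun s ↦ deriv (ξ i) s - (((((Λ i s : lorentzGroup) : E4 ≃L[ℝ] E4) (E4.basisVector 0)) 0)⁻¹ • E4.spatial (((Λ i s : lorentzGroup) : E4 ≃L[ℝ] E4) (E4.basisVector 0)))) t) atTop (𝓝 0)) ∧ (a i ≠ 0 → ∀ m : ℕ, 1 ≤ m → m ≤ 3 → Tendsto (fun t ↦ iteratedDeriv m (fun s ↦ (((Λ i s : lorentzGroup) : E4 ≃L[ℝ] E4) (E4.basisVector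 3))) t) atTop (𝓝 0))) →
    (∀ i : Fin N, ∃ V : E3, Tendsto (deriv (ξ i)) atTop (𝓝 V)) →
    (∀ i : Fin N, ∃ V : E3, Tendsto (fun t : ℝ ↦ t⁻¹ • ξ i t) atTop (𝓝 V)) →
    (∀ (i : Fin N) (t : ℝ), 0 < (((Λ i t : lorentzGroup) : E4 ≃L[ℝ] E4) (E4.basisVector 0)) 0) →
    (∃ τ₁ : ℝ, ∀ x y : U, (τ₁ < x.1 0 ∧ ∀ i, rin i < Kerr.radius (a i) (poincareInv (Λ i (x.1 0)) (E4.ofTimeSpace (x.1 0) (ξ i (x.1 0))) x.1)) → (τ₁ < y.1 0 ∧ ∀ i, rin i < Kerr.radius (a i) (poincareInv (Λ i (y.1 0)) (E4.ofTimeSpace (y.1 0) (ξ i (y.1 0))) y.1)) → Φ y ∈ 𝒟.metric.causalFuture 𝒟.timeOrientation {Φ x} → x.1 0 ≤ y.1 0) →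
    (∀ i : Fin N, ∃ δ K TH : ℝ, 0 < δ ∧ Kerr.rPlus (M i) (a i) + δ < K ∧ ∀ x : U, TH < x.1 0 → (∀ j, Kerr.rPlus (M j) (a j) < Kerr.radius (a j) (poincareInv (Λ j (x.1 0)) (E4.ofTimeSpace (x.1 0) (ξ j (x.1 0))) x.1)) → Kerr.radius (a i) (poincareInv (Λ i (x.1 0)) (E4.ofTimeSpace (x.1 0) (ξ i (x.1 0))) x.1) < Kerr.rPlus (M i) (a i) + δ → ∀ s : ℝ, 0 < s → ∃ (γc : ℝ → 𝒟.carrier) (b : ℝ), 0 < b ∧ 𝒟.metric.IsFutureCausalCurveOn 𝒟.timeOrientation γc (Set.Icc 0 b) ∧ γc 0 = Φ x ∧ γc b ∈ Φ '' {z : U | z.1 0 = x.1 0 + s ∧ Kerr.rPlus (M i) (a i) < Kerr.radius (a i) (poincareInv (Λ i (z.1 0)) (E4.ofTimeSpace (z.1 0) (ξ i (z.1 0))) z.1) ∧ Kerr.radius (a i) (poincareInv (Λ i (z.1 0)) (E4.ofTimeSpace (z.1 0) (ξ i (z.1 0))) z.1) < K} ∧ ∀ σ ∈ Set.Icc 0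 b, γc σ ∈ Φ '' {z : U | x.1 0 ≤ z.1 0 ∧ Kerr.rPlus (M i) (a i) < Kerr.radius (a i) (poincareInv (Λ i (z.1 0)) (E4.ofTimeSpace (z.1 0) (ξ i (z.1 0))) z.1) ∧ Kerr.radius (a i) (poincareInv (Λ i (z.1 0)) (E4.ofTimeSpace (z.1 0) (ξ i (z.1 0))) z.1) < K}) →
    ∃ (O : Set 𝒟.carrier) (d : FinalStateDecomposition 𝒟.toSpacetime O 2), (∀ i, Kerr.IsSubextremal (d.mass i) (d.spin i)) ∧ O = Summit.FinalStateConjecture.exteriorOf 𝒟.toCauchyDevelopment d.charted ∧ Summit.FinalStateConjecture.HasExhaustiveCharts d := by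
  intro X _ _ _ _ _ _ D hD 𝒟 h𝒟 N M a rin Λ ξ γ κ τ₀ U Φ O hL ha hS hVel hCes hOrth hT hHov
  refine inertialRecession_spinZero_of_causal X D hD 𝒟 h𝒟 N M a rin Λ ξ γ κ τ₀ U Φ O hL ha hS hVel
    hCes hOrth ?_ hHov
  obtain ⟨τ₁, hT⟩ := hT
  have hsm := hL.2.2.1
  have hU : {x : E4 | τ₀ < x 0 ∧ ∀ i, rin i < Kerr.radius (a i) (poincareInv (Λ i (x 0))
      (E4.ofTimeSpace (x 0) (ξ i (x 0))) x)} ⊆ (U : Set E4) := hL.2.2.2.2.2.1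
  have hΦ : ContMDiff 𝓘(ℝ, E4) (𝓡 4) ∞ Φ := hL.2.2.2.2.2.2.1
  refine ⟨max τ₀ τ₁, fun x hx hrad w hw htl ↦ ?_⟩
  have hopen := isOpen_setOf_lt_radius_poincareInv a rin Λ ξ (max τ₀ τ₁)
    (fun i ↦ (hsm i).2.continuous) (fun i ↦ (hsm i).1.continuous)
  exact isFutureDirected_mfderiv_of_labTimeCausality hΦ hopen
    (fun z hz ↦ hU ⟨(le_max_left _ _).trans_lt hz.1, hz.2⟩)
    (fun x' y' hx' hy' hJ ↦ hT x' y' ⟨(le_max_right _ _).trans_lt hx'.1, hx'.2⟩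
      ⟨(le_max_right _ _).trans_lt hy'.1, hy'.2⟩ hJ) x ⟨hx, hrad⟩ hw htl

end Summit.FinalStateConjecture.FinalStateConjecture.Theorems

end
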